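import Literature.MathematicalPhysics.QuantumFieldTheory.Balaban1983to89.B9Eq369CurvFormL2

/-!
# `Balaban1983to89.B9Eq369CurvFormConjugation` — T. Bałaban, *Propagators for lattice gauge theories in a background field*, Commun. Math. Phys.
# **99** (1985) 389–434 [Balaban1985BackgroundPropagators] (3.10) p. 392, (3.49) p. 399, (3.69) p. 404, (3.101)–(3.103) p. 414: **THE COMBES–THOMAS
# CONJUGATION LETTER OF THE CURVATURE PART `Δ′` — `‖e^{κχ}Δ′e^{−κχ} − Δ′‖ ≤ 8‖κ‖θ·p_K`** on the chain's `L²` bond space, with the PRODUCT form of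
# (3.69) `‖⟪g, Δ′f⟫‖ ≤ p_K‖g‖‖f‖` and the operator norm `‖Δ′f‖ ≤ p_K‖f‖`, `p_K = 768·|DirPair d|·M_τ·M_φ²·(‖η^d‖∕c₀)·‖η⁻¹‖²·δ`

statement-level skeleton of published theorems with citation tags; proofs where landed; nothing here is a claim about the Yang–Mills mass gap
CITATION HEADER (lean-in-tree rule).  Audit cell `pub-balaban`, sub-cell `t4`, BINDER row NE9; filed by the NE9 BINDER-row OWNER lineage
`b2b-balaban-t4-ne9-p1` (gen 93).  Imports `B9Eq369CurvFormL2` only (this lineage g92: `norm_plaquette_term_le`, `sum_edgeSum_sq_le`, `sum_norm_sq_eq`;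
through it `B9Eq310HessianOperator`: `curvOp`, `inner_curvOp`, `toAlg`; `B9Eq310DeltaPrime`: `curvForm`, `curvBlock₁`, `curvBlock₂`).  Sources READ first-hand
(`paper:balaban1985-cmp99-background-propagators`, journal page = PDF page + 388): p. 404 (3.69) *«Δ′(U′U) is a small, bounded operator»*; p. 399 (3.49);
p. 414 (3.101)–(3.103) (print's own exponential-weight conjugation, inside the random-walk expansion).  Print never conjugates `Δ′` as an operator — the
cell's Combes–Thomas route DISPLAYS the letter `‖SΔ′S⁻¹ − Δ′‖ ≤ β_K` (`B9Eq326ConjugatedLocalLetters.norm_Gk_le` for `A₀`, ne9-leaf-03's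
`B9Eq326ConjugatedDeltaALetters.norm_Gk_le_projected` for `Δ_a`); this file DISCHARGES it down to the model letters of `B9Eq369CurvFormL2`.

WHAT IS PROVED (sorry-free; proof lane — no `def`; [folklore] lattice counting + Hilbert-space plumbing).  Letters DISPLAYED as in `B9Eq369CurvFormL2`
(`hτ`, `hU`, `hRe`, `hIm`, `hφ`, `hstar`); weights `κ : ℂ`, `χ` with `|χ(b₋) − χ(b₊)| ≤ θ`, window `‖κ‖θ ≤ 1`; bond multipliers `S`, `S⁻¹` acting pointwise
as `e^{±κχ(b₋)}` (the `hS`∕`hSinv` of `B9Eq326ConjugatedLocalPart`, VERBATIM).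
* §1 `norm_exp_mul_sub_one_le` (`‖e^{±κΔ} − 1‖ ≤ 2‖κ‖θ`); **`bilin_conj_sub_eq`** (ANY bilinear `Φ`, scalars `s·r = 1`: `Φ(s•w•A, r•w′•B) − Φ(A, B) =
  Φ(A, (w′−1)•B) + Φ((w−1)•A, w′•B)`); `edgeSum_smul_le`.
* §2 **`norm_plaquette_conj_sub_le`**: at the plaquette `p` based at `x`, `e^{κχ}•A = e^{κχ(x)}•(w_p•A)`, `e^{−κχ}•B = e^{−κχ(x)}•(w_p⁻¹•B)`,
  `w_p(b) = e^{κ(χ(b₋)−χ(x))}`, `‖w_p^{±1}(b) − 1‖ ≤ 2‖κ‖θ` on `∂p` ⇒ the plaquette term of `curvForm(e^{κχ}A, e^{−κχ}B) − curvForm(A, B)` is `≤ 8‖κ‖θ ×`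
  g92's `norm_plaquette_term_le`.
* §3 `norm_sum_plaquette_le` (Cauchy–Schwarz over plaquettes: `Σ_p E_A(p)E_B(p) ≤ 16|DirPair d|·a·b` for `Σ‖A‖² ≤ a²`, `Σ‖B‖² ≤ b²`),
  **`norm_curvForm_le_mul`** (product form of (3.69) on the form), **`norm_curvForm_conj_sub_le`**.
* §4 on `BondL2K`: `inner_mulOp_eq` (`⟪g, Sh⟫ = ⟪S̄g, h⟫`), `star_toAlg_conjMul` (`(ēX)* = eX*`), `toAlg_mulOp`, `norm_le_of_inner_le`; **`norm_inner_curvOp_le`**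
  (`‖⟪g, Δ′f⟫‖ ≤ p_K‖g‖‖f‖`), **`norm_curvOp_apply_le`** (`‖Δ′f‖ ≤ p_K‖f‖`), **`norm_inner_conj_curvOp_sub_le`**, and THE LETTER **`norm_conj_curvOp_sub_le`**:
  `‖(S∘Δ′∘S⁻¹)f − Δ′f‖ ≤ 8‖κ‖θ·p_K·‖f‖` — the `dK` hypothesis of `B9Eq326ConjugatedLocalPart.norm_conjLocalInv_le` ∕ `B9Eq326ConjugatedDeltaA.norm_conjG1ofU_le`
  with `β_K := 8‖κ‖θ·p_K = O(‖κ‖θ·α₀)` on (3.35) (`δ = O(α₀η²)`, `c₀ = η^d`).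
HONEST SCOPE.  Crude constants; the model letters stay hypotheses; nothing of [B9] Thm 3.1∕3.3∕3.11 asserted; «NE9 ⇐ the named binders»; NE9 NOT
PRINTED ∕ NOT PROVED; row WALLED ON A MODEL (O-NE9-1; #5 UNRULED); spine PROVED 0∕9; rung (B)+1 on a finite T⁴ — NOT infinite volume, NOT mass gap, NOT
BetaPertH, NOT Clay.  HONEST DEPENDENCY: continuum YM on T⁴ ⇐ BetaPertH ∧ nine spine estimates (0/9 proved); BetaPertH ⇐ (D1) ∧ (D4) ∧ CAP+tail.
NEW file; nothing modified.  Net new unproved facts: 0.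
-/

noncomputable section

open scoped InnerProductSpace ComplexConjugate BigOperators
open Finset

namespace Literature.MathematicalPhysics.QuantumFieldTheory.Balaban1983to89.B9Eq369CurvFormConjugation

open B4Sect5Torus (TSite)
open B9SectCLatticeCarrier (Bond DirPair bpos btgt shift)
open B9Eq311L2Pairing (WL2)
open B11Eq103H1Complex (BondL2K)
open B9Eq310DeltaPrime (reHol imHol curvBlock₁ curvBlock₂ curvForm curvForm_apply)
open B9Eq310HessianOperator (curvOp inner_curvOp toAlg)
open B9Eq369CurvFormL2 (norm_plaquette_term_le sum_edgeSum_sq_le sum_norm_sq_eq)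

/-! ## §1 Scalars, a bilinear identity, weighted boundary sizes -/

section Scalar

/-- **`‖e^{κΔ} − 1‖ ≤ 2‖κ‖θ`** for `|Δ| ≤ θ` in the window `‖κ‖θ ≤ 1`. [folklore] [cite: Balaban1985BackgroundPropagators, (3.49) p.399] -/
theorem norm_exp_mul_sub_one_le {θ Δ : ℝ} {κ : ℂ} (hΔ : |Δ| ≤ θ) (hwin : ‖κ‖ * θ ≤ 1) :
    ‖Complex.exp (κ * (Δ : ℂ)) - 1‖ ≤ 2 * (‖κ‖ * θ) := by
  have hz : ‖κ * (Δ : ℂ)‖ ≤ ‖κ‖ * θ := by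
    rw [norm_mul, Complex.norm_real, Real.norm_eq_abs]
    exact mul_le_mul_of_nonneg_left hΔ (norm_nonneg κ)
  calc ‖Complex.exp (κ * (Δ : ℂ)) - 1‖ ≤ 2 * ‖κ * (Δ : ℂ)‖ := Complex.norm_exp_sub_one_le (hz.trans hwin)
    _ ≤ 2 * (‖κ‖ * θ) := by linarith

/-- **`‖e^{−κΔ} − 1‖ ≤ 2‖κ‖θ`** likewise. [folklore] [cite: Balaban1985BackgroundPropagators, (3.49) p.399] -/
theorem norm_exp_neg_mul_sub_one_le {θ Δ : ℝ} {κ : ℂ} (hΔ : |Δ| ≤ θ) (hwin : ‖κ‖ * θ ≤ 1) :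
    ‖Complex.exp (-(κ * (Δ : ℂ))) - 1‖ ≤ 2 * (‖κ‖ * θ) := by
  have h := norm_exp_mul_sub_one_le (κ := -κ) hΔ (by rwa [norm_neg])
  rwa [norm_neg, neg_mul] at h

/-- `‖e^{−κΔ}‖ ≤ 1 + 2‖κ‖θ` likewise. [folklore] [cite: Balaban1985BackgroundPropagators, (3.49) p.399] -/
theorem norm_exp_neg_mul_le {θ Δ : ℝ} {κ : ℂ} (hΔ : |Δ| ≤ θ) (hwin : ‖κ‖ * θ ≤ 1) :
    ‖Complex.exp (-(κ * (Δ : ℂ)))‖ ≤ 1 + 2 * (‖κ‖ * θ) := by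
  have h := norm_exp_neg_mul_sub_one_le hΔ hwin
  have h2 := norm_add_le (Complex.exp (-(κ * (Δ : ℂ))) - 1) (1 : ℂ)
  rw [sub_add_cancel, norm_one] at h2; linarith

/-- The weight factorises through a base point: `e^{κa} = e^{κc}·e^{κ(a−c)}`. [folklore] [cite: Balaban1985BackgroundPropagators, (3.49) p.399] -/
theorem exp_eq_exp_base_mul (κ : ℂ) (a c : ℝ) : Complex.exp (κ * (a : ℂ)) = Complex.exp (κ * (c : ℂ)) * Complex.exp (κ * ((a - c : ℝ) : ℂ)) := by
  rw [← Complex.exp_add]; push_cast; ring_nf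

/-- `e^{κc}·e^{−κc} = 1`. [folklore] [cite: Balaban1985BackgroundPropagators, (3.49) p.399] -/
theorem exp_mul_exp_neg (κ : ℂ) (c : ℝ) : Complex.exp (κ * (c : ℂ)) * Complex.exp (-(κ * (c : ℂ))) = 1 := by
  rw [← Complex.exp_add, add_neg_cancel, Complex.exp_zero]

/-- **BILINEAR IDENTITY behind the conjugation letter.**  For ANY bilinear `Φ`, scalars `s·r = 1` and weights `σ = s·w`, `ρ = r·w′`:
`Φ(σ•A, ρ•B) − Φ(A, B) = Φ(A, (w′−1)•B) + Φ((w−1)•A, w′•B)`. [folklore] [cite: Balaban1985BackgroundPropagators, (3.101) p.414] -/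
theorem bilin_conj_sub_eq {ι M : Type*} [AddCommGroup M] [Module ℂ M] (Φ : (ι → M) →ₗ[ℂ] (ι → M) →ₗ[ℂ] ℂ) (σ ρ w w' : ι → ℂ) (s r : ℂ)
    (hsr : s * r = 1) (hσ : ∀ i, σ i = s * w i) (hρ : ∀ i, ρ i = r * w' i) (A B : ι → M) :
    Φ (fun i => σ i • A i) (fun i => ρ i • B i) - Φ A B =
      Φ A (fun i => (w' i - 1) • B i) + Φ (fun i => (w i - 1) • A i) (fun i => w' i • B i) := by
  have hA : (fun i => σ i • A i) = s • fun i => w i • A i := by funext i; rw [Pi.smul_apply, smul_smul, hσ]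
  have hB : (fun i => ρ i • B i) = r • fun i => w' i • B i := by funext i; rw [Pi.smul_apply, smul_smul, hρ]
  have hA' : (fun i => w i • A i) = A + fun i => (w i - 1) • A i := by funext i; simp only [Pi.add_apply, sub_smul, one_smul, add_sub_cancel]
  have hB' : (fun i => (w' i - 1) • B i) = (fun i => w' i • B i) - B := by funext i; simp only [Pi.sub_apply, sub_smul, one_smul]
  have h1 : Φ (fun i => σ i • A i) (fun i => ρ i • B i) = Φ (fun i => w i • A i) (fun i => w' i • B i) := by
    rw [hA, hB, LinearMap.map_smul, LinearMap.map_smul, LinearMap.smul_apply, smul_eq_mul, smul_eq_mul]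
    linear_combination (Φ (fun i => w i • A i) (fun i => w' i • B i)) * hsr
  have h2 : Φ (fun i => w i • A i) (fun i => w' i • B i) =
      Φ A (fun i => w' i • B i) + Φ (fun i => (w i - 1) • A i) (fun i => w' i • B i) := by
    rw [hA', map_add, LinearMap.add_apply]
  have h3 : Φ A (fun i => (w' i - 1) • B i) = Φ A (fun i => w' i • B i) - Φ A B := by rw [hB', map_sub]
  rw [h1, h2, h3]
  ring

variable {d : ℕ} {Pd : Fin d → ℕ} {𝔸 : Type*} [NormedRing 𝔸] [NormedAlgebra ℂ 𝔸]

/-- **Weighted boundary size**: `‖c(b)‖ ≤ ω` on the four bonds of `∂p` gives `E_{c•X}(p) ≤ ω·E_X(p)`. [folklore] [cite: Balaban1985BackgroundPropagators, (3.2) p.390] -/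
theorem edgeSum_smul_le (c : Bond d Pd → ℂ) (X : Bond d Pd → 𝔸) (x : TSite d Pd) (q : DirPair d) {ω : ℝ}
    (h1 : ‖c (x, q.1.1)‖ ≤ ω) (h2 : ‖c (x, q.1.2)‖ ≤ ω) (h3 : ‖c (shift q.1.1 x, q.1.2)‖ ≤ ω) (h4 : ‖c (shift q.1.2 x, q.1.1)‖ ≤ ω) :
    ‖c (x, q.1.1) • X (x, q.1.1)‖ + ‖c (x, q.1.2) • X (x, q.1.2)‖ + ‖c (shift q.1.1 x, q.1.2) • X (shift q.1.1 x, q.1.2)‖ +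
        ‖c (shift q.1.2 x, q.1.1) • X (shift q.1.2 x, q.1.1)‖ ≤
      ω * (‖X (x, q.1.1)‖ + ‖X (x, q.1.2)‖ + ‖X (shift q.1.1 x, q.1.2)‖ + ‖X (shift q.1.2 x, q.1.1)‖) := by
  rw [norm_smul, norm_smul, norm_smul, norm_smul]
  linarith [mul_le_mul_of_nonneg_right h1 (norm_nonneg (X (x, q.1.1))), mul_le_mul_of_nonneg_right h2 (norm_nonneg (X (x, q.1.2))),
    mul_le_mul_of_nonneg_right h3 (norm_nonneg (X (shift q.1.1 x, q.1.2))), mul_le_mul_of_nonneg_right h4 (norm_nonneg (X (shift q.1.2 x, q.1.1)))]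

end Scalar

/-! ## §2 One plaquette: the conjugated term minus the term -/

section Plaquette

variable {d : ℕ} {Pd : Fin d → ℕ} {𝔸 : Type*} [NormedRing 𝔸] [NormedAlgebra ℂ 𝔸] (τ : 𝔸 →ₗ[ℂ] ℂ) {Mτ : ℝ}
  (hτ : ∀ X Y : 𝔸, ‖τ (X * Y)‖ ≤ Mτ * ‖X‖ * ‖Y‖) (hMτ : 0 ≤ Mτ)
  (η : ℝ) (U : Bond d Pd → 𝔸ˣ) (hU : ∀ b, ‖(U b : 𝔸)‖ ≤ 1 ∧ ‖(((U b)⁻¹ : 𝔸ˣ) : 𝔸)‖ ≤ 1) {δ : ℝ} (hδ : 0 ≤ δ)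
  (hRe : ∀ p : B9SectCLatticeCarrier.Plaq d Pd, ‖reHol U p - 1‖ ≤ δ) (hIm : ∀ p : B9SectCLatticeCarrier.Plaq d Pd, ‖imHol U p‖ ≤ δ)
  {κ : ℂ} {χ : TSite d Pd → ℝ} {θ : ℝ} (hθ : 0 ≤ θ) (hχ : ∀ b : Bond d Pd, |χ (bpos b) - χ (btgt b)| ≤ θ) (hwin : ‖κ‖ * θ ≤ 1)

include hθ hχ in
/-- The base points of the four bonds of `∂p_{μν}(x)` are within `θ` of `x` in the gauge `χ`. [folklore] [cite: Balaban1985BackgroundPropagators, (3.2) p.390] -/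
theorem abs_sub_base_le (x : TSite d Pd) (q : DirPair d) :
    |χ (bpos ((x, q.1.1) : Bond d Pd)) - χ x| ≤ θ ∧ |χ (bpos ((x, q.1.2) : Bond d Pd)) - χ x| ≤ θ ∧
      |χ (bpos ((shift q.1.1 x, q.1.2) : Bond d Pd)) - χ x| ≤ θ ∧ |χ (bpos ((shift q.1.2 x, q.1.1) : Bond d Pd)) - χ x| ≤ θ := by
  refine ⟨?_, ?_, ?_, ?_⟩
  · show |χ x - χ x| ≤ θ; rw [sub_self, abs_zero]; exact hθ
  · show |χ x - χ x| ≤ θ; rw [sub_self, abs_zero]; exact hθ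
  · show |χ (shift q.1.1 x) - χ x| ≤ θ; rw [abs_sub_comm]; exact hχ (x, q.1.1)
  · show |χ (shift q.1.2 x) - χ x| ≤ θ; rw [abs_sub_comm]; exact hχ (x, q.1.2)

include hτ hMτ hU hδ hRe hIm hθ hχ hwin in
/-- **ONE PLAQUETTE of `curvForm(e^{κχ}A, e^{−κχ}B) − curvForm(A, B)`** is `≤ 8‖κ‖θ·‖η^d‖·48M_τδ‖η⁻¹‖²·E_A(p)·E_B(p)` (base-point weights pulled out by
`bilin_conj_sub_eq`; `norm_plaquette_term_le` twice with `E_{(w−1)•A} ≤ 2‖κ‖θE_A`, `E_{w′•B} ≤ 3E_B`). [cite: Balaban1985BackgroundPropagators, (3.10) p.392, (3.101) p.414] -/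
theorem norm_plaquette_conj_sub_le (A B : Bond d Pd → 𝔸) (x : TSite d Pd) (q : DirPair d) :
    ‖((η : ℂ)) ^ d *
          (curvBlock₁ τ η U (x, q) (fun e => Complex.exp (κ * (χ (bpos e) : ℂ)) • A e) (fun e => Complex.exp (-(κ * (χ (bpos e) : ℂ))) • B e) +
            curvBlock₂ τ η U (x, q) (fun e => Complex.exp (κ * (χ (bpos e) : ℂ)) • A e) (fun e => Complex.exp (-(κ * (χ (bpos e) : ℂ))) • B e)) -
        ((η : ℂ)) ^ d * (curvBlock₁ τ η U (x, q) A B + curvBlock₂ τ η U (x, q) A B)‖ ≤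
      8 * (‖κ‖ * θ) * (‖((η : ℂ)) ^ d‖ * (48 * Mτ * δ * ‖((η : ℂ))⁻¹‖ ^ 2)) *
        ((‖A (x, q.1.1)‖ + ‖A (x, q.1.2)‖ + ‖A (shift q.1.1 x, q.1.2)‖ + ‖A (shift q.1.2 x, q.1.1)‖) *
          (‖B (x, q.1.1)‖ + ‖B (x, q.1.2)‖ + ‖B (shift q.1.1 x, q.1.2)‖ + ‖B (shift q.1.2 x, q.1.1)‖)) := by
  set Φ : (Bond d Pd → 𝔸) →ₗ[ℂ] (Bond d Pd → 𝔸) →ₗ[ℂ] ℂ := ((η : ℂ)) ^ d • (curvBlock₁ τ η U (x, q) + curvBlock₂ τ η U (x, q)) with hΦdef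
  have hΦ : ∀ X Y : Bond d Pd → 𝔸, Φ X Y = ((η : ℂ)) ^ d * (curvBlock₁ τ η U (x, q) X Y + curvBlock₂ τ η U (x, q) X Y) := fun X Y => by
    simp only [hΦdef, LinearMap.smul_apply, LinearMap.add_apply, smul_eq_mul]
  set w : Bond d Pd → ℂ := fun e => Complex.exp (κ * ((χ (bpos e) - χ x : ℝ) : ℂ)) with hw
  set w' : Bond d Pd → ℂ := fun e => Complex.exp (-(κ * ((χ (bpos e) - χ x : ℝ) : ℂ))) with hw'
  have key := bilin_conj_sub_eq Φ (fun e => Complex.exp (κ * (χ (bpos e) : ℂ))) (fun e => Complex.exp (-(κ * (χ (bpos e) : ℂ)))) w w'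
    (Complex.exp (κ * (χ x : ℂ))) (Complex.exp (-(κ * (χ x : ℂ)))) (exp_mul_exp_neg κ (χ x))
    (fun e => exp_eq_exp_base_mul κ (χ (bpos e)) (χ x))
    (fun e => by simpa only [neg_mul] using exp_eq_exp_base_mul (-κ) (χ (bpos e)) (χ x)) A B
  rw [← hΦ, ← hΦ, key]
  set EA := ‖A (x, q.1.1)‖ + ‖A (x, q.1.2)‖ + ‖A (shift q.1.1 x, q.1.2)‖ + ‖A (shift q.1.2 x, q.1.1)‖ with hEA
  set EB := ‖B (x, q.1.1)‖ + ‖B (x, q.1.2)‖ + ‖B (shift q.1.1 x, q.1.2)‖ + ‖B (shift q.1.2 x, q.1.1)‖ with hEB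
  set K : ℝ := ‖((η : ℂ)) ^ d‖ * (48 * Mτ * δ * ‖((η : ℂ))⁻¹‖ ^ 2) with hK
  obtain ⟨hK0, hEA0⟩ : 0 ≤ K ∧ 0 ≤ EA := ⟨by positivity, by positivity⟩
  set ω : ℝ := 2 * (‖κ‖ * θ) with hω
  obtain ⟨hω0, hω2⟩ : 0 ≤ ω ∧ ω ≤ 2 := ⟨by positivity, by rw [hω]; linarith⟩
  obtain ⟨d1, d2, d3, d4⟩ := abs_sub_base_le hθ hχ x q
  have hwA := edgeSum_smul_le (fun e => w e - 1) A x q (norm_exp_mul_sub_one_le d1 hwin) (norm_exp_mul_sub_one_le d2 hwin)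
    (norm_exp_mul_sub_one_le d3 hwin) (norm_exp_mul_sub_one_le d4 hwin)
  have hwB := edgeSum_smul_le (fun e => w' e - 1) B x q (norm_exp_neg_mul_sub_one_le d1 hwin) (norm_exp_neg_mul_sub_one_le d2 hwin)
    (norm_exp_neg_mul_sub_one_le d3 hwin) (norm_exp_neg_mul_sub_one_le d4 hwin)
  have hwB' := edgeSum_smul_le w' B x q (norm_exp_neg_mul_le d1 hwin) (norm_exp_neg_mul_le d2 hwin) (norm_exp_neg_mul_le d3 hwin)
    (norm_exp_neg_mul_le d4 hwin)
  have t1 := norm_plaquette_term_le τ hτ hMτ η U hU hδ hRe hIm A (fun e => (w' e - 1) • B e) x q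
  have t2 := norm_plaquette_term_le τ hτ hMτ η U hU hδ hRe hIm (fun e => (w e - 1) • A e) (fun e => w' e • B e) x q
  rw [← hΦ] at t1 t2
  have b1 : ‖Φ A (fun e => (w' e - 1) • B e)‖ ≤ K * (EA * (ω * EB)) :=
    t1.trans (mul_le_mul_of_nonneg_left (mul_le_mul_of_nonneg_left hwB hEA0) hK0)
  have b2 : ‖Φ (fun e => (w e - 1) • A e) (fun e => w' e • B e)‖ ≤ K * ((ω * EA) * ((1 + ω) * EB)) :=
    t2.trans (mul_le_mul_of_nonneg_left (mul_le_mul hwA hwB' (by positivity) (by positivity)) hK0)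
  calc _ ≤ ‖Φ A (fun e => (w' e - 1) • B e)‖ + ‖Φ (fun e => (w e - 1) • A e) (fun e => w' e • B e)‖ := norm_add_le _ _
    _ ≤ K * (EA * (ω * EB)) + K * ((ω * EA) * ((1 + ω) * EB)) := add_le_add b1 b2
    _ = (K * ω) * (2 + ω) * (EA * EB) := by ring
    _ ≤ (K * ω) * 4 * (EA * EB) :=
        mul_le_mul_of_nonneg_right (mul_le_mul_of_nonneg_left (by linarith) (by positivity)) (by positivity)
    _ = 8 * (‖κ‖ * θ) * K * (EA * EB) := by rw [hω]; ring

end Plaquette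

/-! ## §3 The sum over plaquettes: Cauchy–Schwarz, product forms -/

section Sum

variable {d : ℕ} {Pd : Fin d → ℕ} {𝔸 : Type*} [NormedRing 𝔸] [NormedAlgebra ℂ 𝔸] (τ : 𝔸 →ₗ[ℂ] ℂ) {Mτ : ℝ}
  (hτ : ∀ X Y : 𝔸, ‖τ (X * Y)‖ ≤ Mτ * ‖X‖ * ‖Y‖) (hMτ : 0 ≤ Mτ)
  (η : ℝ) (U : Bond d Pd → 𝔸ˣ) (hU : ∀ b, ‖(U b : 𝔸)‖ ≤ 1 ∧ ‖(((U b)⁻¹ : 𝔸ˣ) : 𝔸)‖ ≤ 1) {δ : ℝ} (hδ : 0 ≤ δ)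
  (hRe : ∀ p : B9SectCLatticeCarrier.Plaq d Pd, ‖reHol U p - 1‖ ≤ δ) (hIm : ∀ p : B9SectCLatticeCarrier.Plaq d Pd, ‖imHol U p‖ ≤ δ)

omit [NormedAlgebra ℂ 𝔸] in
/-- **CAUCHY–SCHWARZ over plaquettes**: a plaquette-wise bound `‖T(p)‖ ≤ K·E_A(p)·E_B(p)` (`K ≥ 0`) sums to `‖Σ_p T(p)‖ ≤ K·16|DirPair d|·a·b`
whenever `Σ_b‖A(b)‖² ≤ a²`, `Σ_b‖B(b)‖² ≤ b²` (`Finset.sum_mul_sq_le_sq_mul_sq` + `sum_edgeSum_sq_le`). [folklore] [cite: Balaban1985BackgroundPropagators, (3.2) p.390] -/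
theorem norm_sum_plaquette_le (A B : Bond d Pd → 𝔸) {a b K : ℝ} (ha : 0 ≤ a) (hb : 0 ≤ b) (hK : 0 ≤ K)
    (hA : ∑ e : Bond d Pd, ‖A e‖ ^ 2 ≤ a ^ 2) (hB : ∑ e : Bond d Pd, ‖B e‖ ^ 2 ≤ b ^ 2) (T : B9SectCLatticeCarrier.Plaq d Pd → ℂ)
    (hT : ∀ (x : TSite d Pd) (q : DirPair d), ‖T (x, q)‖ ≤ K * ((‖A (x, q.1.1)‖ + ‖A (x, q.1.2)‖ + ‖A (shift q.1.1 x, q.1.2)‖ +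
      ‖A (shift q.1.2 x, q.1.1)‖) * (‖B (x, q.1.1)‖ + ‖B (x, q.1.2)‖ + ‖B (shift q.1.1 x, q.1.2)‖ + ‖B (shift q.1.2 x, q.1.1)‖))) :
    ‖∑ p : B9SectCLatticeCarrier.Plaq d Pd, T p‖ ≤ K * (16 * Fintype.card (DirPair d)) * (a * b) := by
  set EA : B9SectCLatticeCarrier.Plaq d Pd → ℝ := fun p =>
    ‖A (p.1, p.2.1.1)‖ + ‖A (p.1, p.2.1.2)‖ + ‖A (shift p.2.1.1 p.1, p.2.1.2)‖ + ‖A (shift p.2.1.2 p.1, p.2.1.1)‖ with hEA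
  set EB : B9SectCLatticeCarrier.Plaq d Pd → ℝ := fun p =>
    ‖B (p.1, p.2.1.1)‖ + ‖B (p.1, p.2.1.2)‖ + ‖B (shift p.2.1.1 p.1, p.2.1.2)‖ + ‖B (shift p.2.1.2 p.1, p.2.1.1)‖ with hEB
  have hEA0 : ∀ p, 0 ≤ EA p := fun p => by rw [hEA]; positivity
  have hEB0 : ∀ p, 0 ≤ EB p := fun p => by rw [hEB]; positivity
  have hSA : ∑ p, EA p ^ 2 ≤ 16 * Fintype.card (DirPair d) * a ^ 2 :=
    (sum_edgeSum_sq_le (Pd := Pd) A).trans (mul_le_mul_of_nonneg_left hA (by positivity))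
  have hSB : ∑ p, EB p ^ 2 ≤ 16 * Fintype.card (DirPair d) * b ^ 2 :=
    (sum_edgeSum_sq_le (Pd := Pd) B).trans (mul_le_mul_of_nonneg_left hB (by positivity))
  have hsq : (∑ p, EA p * EB p) ^ 2 ≤ (16 * Fintype.card (DirPair d) * (a * b)) ^ 2 :=
    calc (∑ p, EA p * EB p) ^ 2 ≤ (∑ p, EA p ^ 2) * ∑ p, EB p ^ 2 := Finset.sum_mul_sq_le_sq_mul_sq _ EA EB
      _ ≤ (16 * Fintype.card (DirPair d) * a ^ 2) * (16 * Fintype.card (DirPair d) * b ^ 2) :=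
          mul_le_mul hSA hSB (Finset.sum_nonneg fun p _ => sq_nonneg _) (by positivity)
      _ = (16 * Fintype.card (DirPair d) * (a * b)) ^ 2 := by ring
  have hS : ∑ p, EA p * EB p ≤ 16 * Fintype.card (DirPair d) * (a * b) :=
    (pow_le_pow_iff_left₀ (Finset.sum_nonneg fun p _ => mul_nonneg (hEA0 p) (hEB0 p)) (by positivity) two_ne_zero).1 hsq
  have hpt : ∀ p : B9SectCLatticeCarrier.Plaq d Pd, ‖T p‖ ≤ K * (EA p * EB p) := by
    rintro ⟨x, q⟩
    exact hT x q
  calc _ ≤ ∑ p : B9SectCLatticeCarrier.Plaq d Pd, K * (EA p * EB p) := (norm_sum_le _ _).trans (Finset.sum_le_sum fun p _ => hpt p)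
    _ ≤ K * (16 * Fintype.card (DirPair d) * (a * b)) := by rw [← Finset.mul_sum]; exact mul_le_mul_of_nonneg_left hS hK
    _ = _ := by ring

include hτ hMτ hU hδ hRe hIm in
/-- **PRODUCT FORM OF (3.69) ON THE FORM**: `‖curvForm τ η U A B‖ ≤ ‖η^d‖·48M_τδ‖η⁻¹‖²·16|DirPair d|·a·b` for `Σ‖A‖² ≤ a²`, `Σ‖B‖² ≤ b²`.
[cite: Balaban1985BackgroundPropagators, (3.10) p.392, (3.69) p.404, (3.35) p.396] -/
theorem norm_curvForm_le_mul (A B : Bond d Pd → 𝔸) {a b : ℝ} (ha : 0 ≤ a) (hb : 0 ≤ b)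
    (hA : ∑ e : Bond d Pd, ‖A e‖ ^ 2 ≤ a ^ 2) (hB : ∑ e : Bond d Pd, ‖B e‖ ^ 2 ≤ b ^ 2) :
    ‖curvForm τ η U A B‖ ≤ (‖((η : ℂ)) ^ d‖ * (48 * Mτ * δ * ‖((η : ℂ))⁻¹‖ ^ 2)) * (16 * Fintype.card (DirPair d)) * (a * b) := by
  rw [curvForm_apply]
  exact norm_sum_plaquette_le A B ha hb (by positivity) hA hB _ fun x q => norm_plaquette_term_le τ hτ hMτ η U hU hδ hRe hIm A B x q

variable {κ : ℂ} {χ : TSite d Pd → ℝ} {θ : ℝ} (hθ : 0 ≤ θ) (hχ : ∀ b : Bond d Pd, |χ (bpos b) - χ (btgt b)| ≤ θ) (hwin : ‖κ‖ * θ ≤ 1)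

include hτ hMτ hU hδ hRe hIm hθ hχ hwin in
/-- **THE CONJUGATED FORM MINUS THE FORM**: `‖curvForm(e^{κχ}A, e^{−κχ}B) − curvForm(A, B)‖ ≤ 8‖κ‖θ·‖η^d‖·48M_τδ‖η⁻¹‖²·16|DirPair d|·a·b` for
`Σ‖A‖² ≤ a²`, `Σ‖B‖² ≤ b²` (`norm_plaquette_conj_sub_le` + `norm_sum_plaquette_le`). [cite: Balaban1985BackgroundPropagators, (3.10) p.392, (3.49) p.399, (3.101) p.414] -/
theorem norm_curvForm_conj_sub_le (A B : Bond d Pd → 𝔸) {a b : ℝ} (ha : 0 ≤ a) (hb : 0 ≤ b)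
    (hA : ∑ e : Bond d Pd, ‖A e‖ ^ 2 ≤ a ^ 2) (hB : ∑ e : Bond d Pd, ‖B e‖ ^ 2 ≤ b ^ 2) :
    ‖curvForm τ η U (fun e => Complex.exp (κ * (χ (bpos e) : ℂ)) • A e) (fun e => Complex.exp (-(κ * (χ (bpos e) : ℂ))) • B e) -
        curvForm τ η U A B‖ ≤
      8 * (‖κ‖ * θ) * (‖((η : ℂ)) ^ d‖ * (48 * Mτ * δ * ‖((η : ℂ))⁻¹‖ ^ 2)) * (16 * Fintype.card (DirPair d)) * (a * b) := by
  rw [curvForm_apply, curvForm_apply, ← Finset.sum_sub_distrib]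
  exact norm_sum_plaquette_le A B ha hb (by positivity) hA hB _
    fun x q => norm_plaquette_conj_sub_le τ hτ hMτ η U hU hδ hRe hIm hθ hχ hwin A B x q

end Sum

/-! ## §4 On the `L²` bond space: the product form of (3.69), the operator norm of `Δ′`, and the conjugation letter -/

section L2

variable {d : ℕ} {Pd : Fin d → ℕ} {𝔸 : Type*} [NormedRing 𝔸] [StarRing 𝔸] [NormedAlgebra ℂ 𝔸] [StarModule ℂ 𝔸]
  {W : Type*} [NormedAddCommGroup W] [InnerProductSpace ℂ W] [FiniteDimensional ℂ W] (φ : W ≃ₗ[ℂ] 𝔸) {Mφ : ℝ}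
  (hφ : ∀ w, ‖φ w‖ ≤ Mφ * ‖w‖) (hMφ : 0 ≤ Mφ) (hstar : ∀ X : 𝔸, ‖star X‖ ≤ ‖X‖)
  {c₀ : ℝ} [Fact (0 < c₀)] (τ : 𝔸 →ₗ[ℂ] ℂ) {Mτ : ℝ} (hτ : ∀ X Y : 𝔸, ‖τ (X * Y)‖ ≤ Mτ * ‖X‖ * ‖Y‖) (hMτ : 0 ≤ Mτ)
  (η : ℝ) (U : Bond d Pd → 𝔸ˣ) (hU : ∀ b, ‖(U b : 𝔸)‖ ≤ 1 ∧ ‖(((U b)⁻¹ : 𝔸ˣ) : 𝔸)‖ ≤ 1) {δ : ℝ} (hδ : 0 ≤ δ)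
  (hRe : ∀ p : B9SectCLatticeCarrier.Plaq d Pd, ‖reHol U p - 1‖ ≤ δ) (hIm : ∀ p : B9SectCLatticeCarrier.Plaq d Pd, ‖imHol U p‖ ≤ δ)

omit [StarRing 𝔸] [StarModule ℂ 𝔸] [FiniteDimensional ℂ W] in
/-- **`⟪g, Sh⟫ = ⟪S̄g, h⟫` for pointwise scalar multipliers** `S = e(b)•`, `S̄ = ē(b)•` on the weighted `L²` bond space. [folklore]
[cite: Balaban1985BackgroundPropagators, (3.11) p.392, (3.49) p.399] -/
theorem inner_mulOp_eq (e : Bond d Pd → ℂ) {S Sc : BondL2K ℂ d Pd c₀ W → BondL2K ℂ d Pd c₀ W}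
    (hS : ∀ (h : BondL2K ℂ d Pd c₀ W) (b : Bond d Pd),
      WL2.equiv ℂ (fun _ : Bond d Pd => c₀) W (S h) b = e b • WL2.equiv ℂ (fun _ : Bond d Pd => c₀) W h b)
    (hSc : ∀ (g : BondL2K ℂ d Pd c₀ W) (b : Bond d Pd),
      WL2.equiv ℂ (fun _ : Bond d Pd => c₀) W (Sc g) b = (starRingEnd ℂ) (e b) • WL2.equiv ℂ (fun _ : Bond d Pd => c₀) W g b)
    (g h : BondL2K ℂ d Pd c₀ W) : ⟪g, S h⟫_ℂ = ⟪Sc g, h⟫_ℂ := by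
  rw [WL2.inner_def, WL2.inner_def]
  refine Finset.sum_congr rfl fun b _ => ?_
  rw [hS, hSc, inner_smul_right, inner_smul_left, starRingEnd_self_apply]

omit [FiniteDimensional ℂ W] [Fact (0 < c₀)] in
/-- The algebra reading of `S̄g`, starred: `(Φ(S̄g))*(b) = e(b)•(Φg)*(b)` (`(ēX)* = eX*`). [folklore] [cite: Balaban1985Averaging, (18) p.21] -/
theorem star_toAlg_conjMul (e : Bond d Pd → ℂ) {Sc : BondL2K ℂ d Pd c₀ W → BondL2K ℂ d Pd c₀ W}
    (hSc : ∀ (g : BondL2K ℂ d Pd c₀ W) (b : Bond d Pd),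
      WL2.equiv ℂ (fun _ : Bond d Pd => c₀) W (Sc g) b = (starRingEnd ℂ) (e b) • WL2.equiv ℂ (fun _ : Bond d Pd => c₀) W g b)
    (g : BondL2K ℂ d Pd c₀ W) : star (toAlg φ (Sc g)) = fun b => e b • star (toAlg φ g) b := by
  funext b
  show star (φ (WL2.equiv ℂ (fun _ : Bond d Pd => c₀) W (Sc g) b)) = e b • star (φ (WL2.equiv ℂ (fun _ : Bond d Pd => c₀) W g b))
  rw [hSc, LinearEquiv.map_smul, star_smul, RCLike.star_def, starRingEnd_self_apply]

omit [StarRing 𝔸] [StarModule ℂ 𝔸] [FiniteDimensional ℂ W] [Fact (0 < c₀)] in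
/-- The algebra reading of `S⁻¹f`: `Φ(S⁻¹f)(b) = e′(b)•(Φf)(b)`. [folklore] [cite: Balaban1985Averaging, (18) p.21] -/
theorem toAlg_mulOp (e' : Bond d Pd → ℂ) {Si : BondL2K ℂ d Pd c₀ W → BondL2K ℂ d Pd c₀ W}
    (hSi : ∀ (f : BondL2K ℂ d Pd c₀ W) (b : Bond d Pd),
      WL2.equiv ℂ (fun _ : Bond d Pd => c₀) W (Si f) b = e' b • WL2.equiv ℂ (fun _ : Bond d Pd => c₀) W f b)
    (f : BondL2K ℂ d Pd c₀ W) : toAlg φ (Si f) = fun b => e' b • toAlg φ f b := by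
  funext b
  show φ (WL2.equiv ℂ (fun _ : Bond d Pd => c₀) W (Si f) b) = e' b • φ (WL2.equiv ℂ (fun _ : Bond d Pd => c₀) W f b)
  rw [hSi, LinearEquiv.map_smul]

omit [StarRing 𝔸] [StarModule ℂ 𝔸] [FiniteDimensional ℂ W] in
include hφ in
/-- `Σ_b‖X(b)‖² ≤ (M_φ‖f‖∕√c₀)²` for any reading `X` with `‖X(b)‖ ≤ ‖(Φf)(b)‖` (used for `X = Φf` and `X = (Φf)*`).
[cite: Balaban1985Averaging, (18) p.21; Balaban1985BackgroundPropagators, (3.11) p.392] -/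
theorem sum_norm_sq_toAlg_le' (f : BondL2K ℂ d Pd c₀ W) (X : Bond d Pd → 𝔸) (hX : ∀ b, ‖X b‖ ≤ ‖toAlg φ f b‖) :
    ∑ b : Bond d Pd, ‖X b‖ ^ 2 ≤ (Mφ * ‖f‖ / Real.sqrt c₀) ^ 2 := by
  have hc₀ : 0 < c₀ := Fact.out
  have hb : ∀ b : Bond d Pd, ‖X b‖ ≤ Mφ * ‖WL2.equiv ℂ (fun _ : Bond d Pd => c₀) W f b‖ := fun b => (hX b).trans (hφ _)
  calc ∑ b : Bond d Pd, ‖X b‖ ^ 2 ≤ ∑ b : Bond d Pd, (Mφ * ‖WL2.equiv ℂ (fun _ : Bond d Pd => c₀) W f b‖) ^ 2 :=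
        Finset.sum_le_sum fun b _ => pow_le_pow_left₀ (norm_nonneg _) (hb b) 2
    _ = Mφ ^ 2 * (‖f‖ ^ 2 / c₀) := by
        rw [← sum_norm_sq_eq f, Finset.mul_sum]; exact Finset.sum_congr rfl fun b _ => by ring
    _ = (Mφ * ‖f‖ / Real.sqrt c₀) ^ 2 := by rw [div_pow, mul_pow, Real.sq_sqrt hc₀.le]; ring

omit [StarRing 𝔸] [StarModule ℂ 𝔸] [FiniteDimensional ℂ W] [NormedAddCommGroup W] [InnerProductSpace ℂ W] in
/-- `(M_φs∕√c₀)·(M_φt∕√c₀) = M_φ²st∕c₀`. [folklore] [cite: Balaban1985BackgroundPropagators, (3.11) p.392] -/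
theorem sqrt_weights_mul (s t : ℝ) : (Mφ * s / Real.sqrt c₀) * (Mφ * t / Real.sqrt c₀) = Mφ ^ 2 * s * t / c₀ := by
  have hc₀ : 0 < c₀ := Fact.out
  rw [div_mul_div_comm, Real.mul_self_sqrt hc₀.le]; ring

omit [StarRing 𝔸] [StarModule ℂ 𝔸] [FiniteDimensional ℂ W] in
/-- From `‖⟪v, v⟫‖ ≤ C‖v‖‖f‖` (`C ≥ 0`) to `‖v‖ ≤ C‖f‖`. [folklore] [cite: Balaban1985BackgroundPropagators, (3.11) p.392] -/
theorem norm_le_of_inner_le (v f : BondL2K ℂ d Pd c₀ W) {C : ℝ} (hC : 0 ≤ C) (h : ‖⟪v, v⟫_ℂ‖ ≤ C * (‖v‖ * ‖f‖)) : ‖v‖ ≤ C * ‖f‖ := by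
  have h1 : ‖v‖ ^ 2 ≤ C * (‖v‖ * ‖f‖) :=
    calc ‖v‖ ^ 2 = RCLike.re ⟪v, v⟫_ℂ := (inner_self_eq_norm_sq v).symm
      _ ≤ ‖⟪v, v⟫_ℂ‖ := RCLike.re_le_norm _
      _ ≤ C * (‖v‖ * ‖f‖) := h
  by_cases h0 : ‖v‖ = 0
  · rw [h0]; positivity
  · have hpos : 0 < ‖v‖ := lt_of_le_of_ne (norm_nonneg _) (Ne.symm h0)
    have h2 : ‖v‖ * ‖v‖ ≤ (C * ‖f‖) * ‖v‖ := by nlinarith [h1]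
    exact le_of_mul_le_mul_right h2 hpos

include hφ hMφ hstar hτ hMτ hU hδ hRe hIm in
/-- **PRODUCT FORM OF (3.69) ON THE OPERATOR: `‖⟪g, Δ′f⟫‖ ≤ p_K‖g‖‖f‖`**, `p_K = 768·|DirPair d|·M_τ·M_φ²·(‖η^d‖∕c₀)·‖η⁻¹‖²·δ` (the constant of
`B9Eq369CurvFormL2.norm_inner_curvOp_self_le`, off the diagonal by Cauchy–Schwarz). [cite: Balaban1985BackgroundPropagators, (3.10) p.392, (3.69) p.404, (3.35) p.396] -/
theorem norm_inner_curvOp_le (g f : BondL2K ℂ d Pd c₀ W) :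
    ‖⟪g, curvOp φ τ η U f⟫_ℂ‖ ≤ 768 * Fintype.card (DirPair d) * Mτ * Mφ ^ 2 * (‖((η : ℂ)) ^ d‖ / c₀) * ‖((η : ℂ))⁻¹‖ ^ 2 * δ * (‖g‖ * ‖f‖) := by
  have hc₀ : 0 < c₀ := Fact.out
  rw [inner_curvOp]
  have h := norm_curvForm_le_mul τ hτ hMτ η U hU hδ hRe hIm (star (toAlg φ g)) (toAlg φ f) (by positivity) (by positivity)
    (sum_norm_sq_toAlg_le' φ hφ g _ fun b => hstar _) (sum_norm_sq_toAlg_le' φ hφ f _ fun b => le_rfl)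
  rw [sqrt_weights_mul (c₀ := c₀) (Mφ := Mφ)] at h
  refine h.trans (le_of_eq ?_)
  rw [div_eq_mul_inv, div_eq_mul_inv]; ring

include hφ hMφ hstar hτ hMτ hU hδ hRe hIm in
/-- **THE OPERATOR NORM OF `Δ′`: `‖Δ′f‖ ≤ p_K‖f‖`** («a small, bounded operator», (3.69) in the `L²` currency). [cite: Balaban1985BackgroundPropagators, (3.69) p.404, (3.10) p.392, (3.35) p.396] -/
theorem norm_curvOp_apply_le (f : BondL2K ℂ d Pd c₀ W) :
    ‖curvOp φ τ η U f‖ ≤ 768 * Fintype.card (DirPair d) * Mτ * Mφ ^ 2 * (‖((η : ℂ)) ^ d‖ / c₀) * ‖((η : ℂ))⁻¹‖ ^ 2 * δ * ‖f‖ := by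
  have hc₀ : 0 < c₀ := Fact.out
  exact norm_le_of_inner_le _ f (by positivity) (norm_inner_curvOp_le φ hφ hMφ hstar τ hτ hMτ η U hU hδ hRe hIm _ f)

variable {κ : ℂ} {χ : TSite d Pd → ℝ} {θ : ℝ} (hθ : 0 ≤ θ) (hχ : ∀ b : Bond d Pd, |χ (bpos b) - χ (btgt b)| ≤ θ) (hwin : ‖κ‖ * θ ≤ 1)
  {S Sinv : BondL2K ℂ d Pd c₀ W →ₗ[ℂ] BondL2K ℂ d Pd c₀ W}
  (hS : ∀ (g : BondL2K ℂ d Pd c₀ W) (b : Bond d Pd),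
    WL2.equiv ℂ (fun _ : Bond d Pd => c₀) W (S g) b = Complex.exp (κ * (χ (bpos b) : ℂ)) • WL2.equiv ℂ (fun _ : Bond d Pd => c₀) W g b)
  (hSinv : ∀ (g : BondL2K ℂ d Pd c₀ W) (b : Bond d Pd),
    WL2.equiv ℂ (fun _ : Bond d Pd => c₀) W (Sinv g) b = Complex.exp (-(κ * (χ (bpos b) : ℂ))) • WL2.equiv ℂ (fun _ : Bond d Pd => c₀) W g b)

include hφ hMφ hstar hτ hMτ hU hδ hRe hIm hθ hχ hwin hS hSinv in
/-- **`‖⟪g, SΔ′S⁻¹f − Δ′f⟫‖ ≤ 8‖κ‖θ·p_K·‖g‖‖f‖`**: `⟪g, SΔ′S⁻¹f⟫ = ⟪S̄g, Δ′(S⁻¹f)⟫ = curvForm(e^{κχ}(Φg)*, e^{−κχ}Φf)` (`(ēX)* = eX*`), then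
`norm_curvForm_conj_sub_le`. [cite: Balaban1985BackgroundPropagators, (3.10) p.392, (3.49) p.399, (3.69) p.404, (3.101) p.414] -/
theorem norm_inner_conj_curvOp_sub_le (g f : BondL2K ℂ d Pd c₀ W) :
    ‖⟪g, S (curvOp φ τ η U (Sinv f)) - curvOp φ τ η U f⟫_ℂ‖ ≤
      8 * (‖κ‖ * θ) * (768 * Fintype.card (DirPair d) * Mτ * Mφ ^ 2 * (‖((η : ℂ)) ^ d‖ / c₀) * ‖((η : ℂ))⁻¹‖ ^ 2 * δ) * (‖g‖ * ‖f‖) := by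
  have hc₀ : 0 < c₀ := Fact.out
  set Sc : BondL2K ℂ d Pd c₀ W → BondL2K ℂ d Pd c₀ W := fun g =>
    (WL2.equiv ℂ (fun _ : Bond d Pd => c₀) W).symm fun b =>
      (starRingEnd ℂ) (Complex.exp (κ * (χ (bpos b) : ℂ))) • WL2.equiv ℂ (fun _ : Bond d Pd => c₀) W g b with hScdef
  have hSc : ∀ (g : BondL2K ℂ d Pd c₀ W) (b : Bond d Pd), WL2.equiv ℂ (fun _ : Bond d Pd => c₀) W (Sc g) b =
      (starRingEnd ℂ) (Complex.exp (κ * (χ (bpos b) : ℂ))) • WL2.equiv ℂ (fun _ : Bond d Pd => c₀) W g b := fun g b => rfl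
  rw [inner_sub_right, inner_mulOp_eq (fun b => Complex.exp (κ * (χ (bpos b) : ℂ))) (S := S) (Sc := Sc) hS hSc, inner_curvOp, inner_curvOp,
    star_toAlg_conjMul φ (fun b => Complex.exp (κ * (χ (bpos b) : ℂ))) hSc g,
    toAlg_mulOp φ (fun b => Complex.exp (-(κ * (χ (bpos b) : ℂ)))) hSinv f]
  have h := norm_curvForm_conj_sub_le τ hτ hMτ η U hU hδ hRe hIm hθ hχ hwin (star (toAlg φ g)) (toAlg φ f) (by positivity) (by positivity)
    (sum_norm_sq_toAlg_le' φ hφ g _ fun b => hstar _) (sum_norm_sq_toAlg_le' φ hφ f _ fun b => le_rfl)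
  rw [sqrt_weights_mul (c₀ := c₀) (Mφ := Mφ)] at h
  refine h.trans (le_of_eq ?_)
  rw [div_eq_mul_inv, div_eq_mul_inv]; ring

include hφ hMφ hstar hτ hMτ hU hδ hRe hIm hθ hχ hwin hS hSinv in
/-- **THE COMBES–THOMAS CONJUGATION LETTER OF `Δ′`: `‖(S∘Δ′∘S⁻¹)f − Δ′f‖ ≤ 8‖κ‖θ·p_K·‖f‖`**, `p_K = 768·|DirPair d|·M_τ·M_φ²·(‖η^d‖∕c₀)·‖η⁻¹‖²·δ` —
the `dK` hypothesis of `B9Eq326ConjugatedLocalPart.norm_conjLocalInv_le` (and of ne9-leaf-03's `Δ_a` twin `B9Eq326ConjugatedDeltaA.norm_conjG1ofU_le`) with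
`β_K := 8‖κ‖θ·p_K`, bond multipliers `S = e^{κχ(b₋)}`, `S⁻¹ = e^{−κχ(b₋)}`, `|χ(b₋) − χ(b₊)| ≤ θ`, `‖κ‖θ ≤ 1`; on (3.35) (`δ = O(α₀η²)`, `c₀ = η^d`) `β_K = O(‖κ‖θ·α₀)`.
[cite: Balaban1985BackgroundPropagators, (3.69) p.404, (3.49) p.399, (3.10) p.392, (3.101) p.414, (3.35) p.396] -/
theorem norm_conj_curvOp_sub_le (f : BondL2K ℂ d Pd c₀ W) :
    ‖(S ∘ₗ curvOp φ τ η U ∘ₗ Sinv) f - curvOp φ τ η U f‖ ≤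
      8 * (‖κ‖ * θ) * (768 * Fintype.card (DirPair d) * Mτ * Mφ ^ 2 * (‖((η : ℂ)) ^ d‖ / c₀) * ‖((η : ℂ))⁻¹‖ ^ 2 * δ) * ‖f‖ := by
  have hc₀ : 0 < c₀ := Fact.out
  have h := norm_inner_conj_curvOp_sub_le φ hφ hMφ hstar τ hτ hMτ η U hU hδ hRe hIm hθ hχ hwin hS hSinv
    ((S ∘ₗ curvOp φ τ η U ∘ₗ Sinv) f - curvOp φ τ η U f) f
  exact norm_le_of_inner_le _ f (by positivity) h

end L2

end Literature.MathematicalPhysics.QuantumFieldTheory.Balaban1983to89.B9Eq369CurvFormConjugation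

end
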